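import Literature.Computability.AlgebraicComplexity.DIP20MonomialCounts
import Literature.Computability.AlgebraicComplexity.DIP20PlethysmCountingFormulaProofs
import HarnessLib

/-!
# Dörfler–Ikenmeyer–Panova 2019, Prop. 4.7 (the key difference formula) from the corrected
# Prop. 4.5 (iii): `a_λ(d[n]) - a_λ(n[d])` for `λ = (L, r, 2)` as a `q`-series coefficient

Topic `Literature/Computability/AlgebraicComplexity`; sibling proofs file (D-0014) of
`DIP20MultiplicityObstructions.lean` (named facts `DIP20_prop_4_7`, `DIP20_thm_3_5` — both DISCHARGED
here; definitions `dipMonomialCount`, `gaussBinomial`, `toRatPowerSeries`). No new facts, no new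
definitions.

J. Dörfler, C. Ikenmeyer, G. Panova, SIAM J. Appl. Algebra Geom. 4 (2020) = arXiv:1901.04576, Prop. 4.7
(arXiv p. 11; TeX `multobs.tex` L666 `{prop:difference}`): "Let `λ = (L,r,2)`. We have that
`a_λ(d[n]) - a_λ(n[d]) = (q^r) @ binom(n+d-2,n-1)_q (q^n - q^d)(1-q^{d-1})(1-q^{n-1}) / ((1-q^d)(1-q^n))`."
The printed proof goes through Prop. 4.5 (the generating functions of `c_{(L,k,j)}`, `j = 0,1,2`) and
Prop. 4.6; the printed third identity of Prop. 4.5 carries a misprint (erratum candidate E2 of the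
statement file; the corrected reading is
`c_{(L,k,2)}(d,n) = (q^k) @ (binom(n-1,1)_q binom(n+d-1,n)_q + binom(n+1,2)_q binom(n+d-2,n)_q)`,
one vector with last coordinate `2` or two with last coordinate `1`), and Prop. 4.7 is correct as
printed. This file proves **`DIP20_prop_4_7_of_row_two_two`: the corrected third identity implies
`DIP20_prop_4_7`**, following the printed route:

* §G1 `plethysmCoeff_row_two_two_cast_eq`: (4.4) (`DIP20_eq_4_4_holds`) for `λ = (L,r,2)` written out
  over the six permutations of `𝔖₃`:
  `a_λ(d[n]) = c_{(L,r,2)} - c_{(L+1,r-1,2)} - c_{(L+2,r,0)} - c_{(L,r+1,1)} + c_{(L+2,r-1,1)} + c_{(L+1,r+1,0)}`;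
* §G2: the `ν₃ = 0` terms are `p_k(d,n)`, symmetric in `(n,d)` (Prop. 4.5 (i), `boxPartitionCount_symm`);
  the `ν₃ = 1` terms have generating polynomial `binom(n,1)_q binom(n+d-1,n)_q`, ALSO symmetric in
  `(n,d)` (`gaussBinomial_one_mul_symm`, by the absorption rules of `DIP20MonomialCounts` §F); hence
  only the `ν₃ = 2` terms survive in the difference, which is `(q^r) @ (1-q)(G₂(d,n) - G₂(n,d))`, and
  `dip_prop47_polynomial_identity`: `(1-q)(G₂(d,n) - G₂(n,d)) · (1-q^d)(1-q^n)
   = binom(n+d-2,n-1)_q (q^n - q^d)(1-q^{d-1})(1-q^{n-1})` in `ℤ[q]` (absorption rules again);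
* §G3: transport to `ℚ⟦q⟧` (`toRatPowerSeries`) and division by the invertible `(1-q^d)(1-q^n)`.

§G4 then DISCHARGES the facts: the corrected Prop. 4.5 (iii) is a theorem of the sibling
`DIP20MonomialCounts.lean` (§G, `dipMonomialCount_row_two_two_cast`), so **`DIP20_prop_4_7_holds`**,
**`DIP20_thm_3_5_holds`** (via the statement file's `DIP20_thm_3_5_of_prop_4_7`), and Cor. 4.8's clauses
`r < n` / `r = n` unconditionally (`dip20_cor_4_8_of_lt`, `dip20_cor_4_8_of_eq`). §G5 proves the printed
difference formula for `r > n` (`dip20_cor_4_8_diff_eq_boxCounts`: `= p_{r-n}(n+1,n-2) - p_{r-n-1}(n+1,n-2)`),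
hence the `(8,35)` clause (`dip20_cor_4_8_eight_thirtyfive`) and the unlisted zero at `r = n+1`
(`dip20_cor_4_8_at_succ`, erratum E3 as a theorem) and at `(9, 44)` (`dip20_cor_4_8_nine_fortyfour`,
erratum E4 as a theorem, §G7); §G6 reduces the typed `DIP20_cor_4_8` EXACTLY to the
(strict) unimodality of the Gaussian coefficients `p_k(n+1,n-2)` (`DIP20_cor_4_8_of_gaussian_unimodality`;
Sylvester / Pak–Panova, not in the tree, kept as hypotheses).

HONEST FRAMING: `q`-series bookkeeping of the toy model's §4; nothing here bears on permanent versus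
determinant; VP ≠ VNP is not proved.

## References

* J. Dörfler, C. Ikenmeyer, G. Panova, SIAM J. Appl. Algebra Geom. 4 (2020) = arXiv:1901.04576,
  eqs. (4.3)–(4.4), Props. 4.5–4.7 (arXiv pp. 9–11). [DorflerIkenmeyerPanova2020]
* G. E. Andrews, *The Theory of Partitions* (1976/1984), Thms. 3.1–3.2 (Gaussian polynomials). [Andrews1984]

## Mathlib and tree

Mathlib: `Equiv.Perm.sign_swap`, `Equiv.swap_apply_of_ne_of_ne`, `Polynomial.coeff_X_mul`,
`Polynomial.coe_mul`, `Polynomial.coeff_coe`, `PowerSeries.mul_inv_cancel`, `linear_combination`.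
Tree: `DIP20_eq_4_4_holds` (`DIP20PlethysmCountingFormulaProofs`), `dipMonomialCount_row_two_zero`,
`dipMonomialCount_row_two_one`, `coeff_gaussBinomial(_one_mul)`, `boxPartitionCount_symm`,
`gaussBinomial_symm`, `gaussBinomial_absorb_left`, `gaussBinomial_cross`,
`one_sub_X_mul_gaussBinomial_one`, `one_sub_X_mul_one_sub_X_sq_mul_gaussBinomial_two`
(`DIP20MonomialCounts`), `DIP20_prop_4_7`, `toRatPowerSeries` (`DIP20MultiplicityObstructions`).

Provenance: val-lit cell, typer val-lit-t07 g2 (DAG row DIP2020-A, discharge pass; registry claim #1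
on `DIP20_prop_4_7`).
-/

noncomputable section

namespace Literature.Computability.AlgebraicComplexity

open _root_.Literature.NumberTheory.DiophantineGeometry

/-! ### §G1. Sums over `𝔖₃` -/

section PermFinThree

/-- The six permutations of `Fin 3`. [folklore] -/
private theorem univ_perm_fin_three :
    (Finset.univ : Finset (Equiv.Perm (Fin 3))) =
      {1, Equiv.swap 0 1, Equiv.swap 0 2, Equiv.swap 1 2, Equiv.swap 0 1 * Equiv.swap 0 2,
        Equiv.swap 0 2 * Equiv.swap 0 1} := by
  decide

/-- A sum over `𝔖₃`, term by term. [folklore] -/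
private theorem sum_perm_fin_three {M : Type} [AddCommMonoid M] (f : Equiv.Perm (Fin 3) → M) :
    ∑ π, f π = f 1 + (f (Equiv.swap 0 1) + (f (Equiv.swap 0 2) + (f (Equiv.swap 1 2) +
      (f (Equiv.swap 0 1 * Equiv.swap 0 2) + f (Equiv.swap 0 2 * Equiv.swap 0 1))))) := by
  rw [univ_perm_fin_three, Finset.sum_insert (by decide), Finset.sum_insert (by decide),
    Finset.sum_insert (by decide), Finset.sum_insert (by decide), Finset.sum_insert (by decide),
    Finset.sum_singleton]

/-- One term of (4.4): when the guard holds, it is `c_ν(d,n)` for the shifted row vector `ν`.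
[cite: DorflerIkenmeyerPanova2020, eq. (4.4) (arXiv p. 9)] -/
private theorem dip44_term_eq (lam : Fin 3 → ℕ) (π : Equiv.Perm (Fin 3)) (ν : Fin 3 → ℕ) (d n : ℕ)
    (hcond : ∀ i : Fin 3, (i : ℕ) ≤ lam i + (π i : ℕ))
    (hν : ∀ i : Fin 3, lam i + (π i : ℕ) - (i : ℕ) = ν i) :
    (if ∀ i : Fin 3, (i : ℕ) ≤ lam i + (π i : ℕ)
      then (dipMonomialCount (fun i : Fin 3 => lam i + (π i : ℕ) - (i : ℕ)) d n : ℤ) else 0) =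
      dipMonomialCount ν d n := by
  rw [if_pos hcond]
  congr 2
  funext i
  exact hν i

/-- **(4.4) for `λ = (L, r, 2)` written out** (`2 ≤ r ≤ L`, `n ≥ 1`, `λ ⊢ dn`):
`a_λ(d[n]) = c_{(L,r,2)} - c_{(L+1,r-1,2)} - c_{(L+2,r,0)} - c_{(L,r+1,1)} + c_{(L+1,r+1,0)} + c_{(L+2,r-1,1)}`
(the six permutations `id, (01), (02), (12), (01)(02) = (0→2→1), (02)(01) = (0→1→2)` of `𝔖₃`; all
guards hold).
[cite: DorflerIkenmeyerPanova2020, eq. (4.4) (arXiv p. 9; TeX multobs.tex L590 {eq:pleth_det})] -/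
theorem plethysmCoeff_row_two_two_cast_eq {n d L r : ℕ} (hn : 0 < n) (hr : 2 ≤ r) (hrL : r ≤ L)
    (hsum : L + r + 2 = d * n) :
    (plethysmCoeff ℂ (Fin 3) n (rowDual ![L, r, 2]) : ℤ) =
      (dipMonomialCount ![L, r, 2] d n : ℤ) - dipMonomialCount ![L + 1, r - 1, 2] d n
        - dipMonomialCount ![L + 2, r, 0] d n - dipMonomialCount ![L, r + 1, 1] d n
        + dipMonomialCount ![L + 1, r + 1, 0] d n + dipMonomialCount ![L + 2, r - 1, 1] d n := by
  have hanti : Antitone ![L, r, 2] := by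
    intro i j hij
    fin_cases i <;> fin_cases j <;> simp at hij ⊢ <;> omega
  have h := DIP20_eq_4_4_holds 3 n d ![L, r, 2] hn hanti (by simp [Fin.sum_univ_three]; omega)
  rw [sum_perm_fin_three] at h
  rw [dip44_term_eq ![L, r, 2] 1 ![L, r, 2] d n
      (by intro i; fin_cases i <;> simp)
      (by intro i; fin_cases i <;> simp),
    dip44_term_eq ![L, r, 2] (Equiv.swap 0 1) ![L + 1, r - 1, 2] d n
      (by intro i; fin_cases i <;> simp [Equiv.swap_apply_of_ne_of_ne]; omega)
      (by intro i; fin_cases i <;> simp [Equiv.swap_apply_of_ne_of_ne]),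
    dip44_term_eq ![L, r, 2] (Equiv.swap 0 2) ![L + 2, r, 0] d n
      (by intro i; fin_cases i <;> simp [Equiv.swap_apply_of_ne_of_ne])
      (by intro i; fin_cases i <;> simp [Equiv.swap_apply_of_ne_of_ne]),
    dip44_term_eq ![L, r, 2] (Equiv.swap 1 2) ![L, r + 1, 1] d n
      (by intro i; fin_cases i <;> simp [Equiv.swap_apply_of_ne_of_ne])
      (by intro i; fin_cases i <;> simp [Equiv.swap_apply_of_ne_of_ne]),
    dip44_term_eq ![L, r, 2] (Equiv.swap 0 1 * Equiv.swap 0 2) ![L + 2, r - 1, 1] d n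
      (by intro i; fin_cases i <;> simp [Equiv.swap_apply_of_ne_of_ne]; omega)
      (by intro i; fin_cases i <;> simp [Equiv.swap_apply_of_ne_of_ne]),
    dip44_term_eq ![L, r, 2] (Equiv.swap 0 2 * Equiv.swap 0 1) ![L + 1, r + 1, 0] d n
      (by intro i; fin_cases i <;> simp [Equiv.swap_apply_of_ne_of_ne])
      (by intro i; fin_cases i <;> simp [Equiv.swap_apply_of_ne_of_ne])] at h
  rw [h]
  simp [Equiv.Perm.sign_mul]
  ring

end PermFinThree

/-! ### §G2. The generating polynomials of the three kinds of terms -/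

section GeneratingPolynomials

/-- `c_{(L,j,0)}(d,n) = (q^j) @ binom(n+d,d)_q`. [cite: DorflerIkenmeyerPanova2020, Prop. 4.5 (i) (arXiv p. 9)] -/
theorem dipMonomialCount_row_two_zero_cast {n d L j : ℕ} (hL : L + j = d * n) :
    (dipMonomialCount ![L, j, 0] d n : ℤ) = (gaussBinomial d n).coeff j := by
  rw [dipMonomialCount_row_two_zero hL, coeff_gaussBinomial]

/-- `c_{(L,j,1)}(d,n) = (q^j) @ binom(n,1)_q binom(n+d-1,n)_q` (as integers, no side condition on
`j`). [cite: DorflerIkenmeyerPanova2020, Prop. 4.5 (ii) (arXiv p. 9)] -/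
theorem dipMonomialCount_row_two_one_cast {n d L j : ℕ} (hn : 1 ≤ n) (hd : 1 ≤ d)
    (hL : L + j + 1 = d * n) :
    (dipMonomialCount ![L, j, 1] d n : ℤ) = (gaussBinomial 1 (n - 1) * gaussBinomial n (d - 1)).coeff j := by
  rw [dipMonomialCount_row_two_one hn hd hL, coeff_gaussBinomial_one_mul, Nat.cast_sum]
  exact Finset.sum_congr rfl fun i _ => by rw [boxPartitionCount_symm]

/-- `1 - q ≠ 0` in `ℤ[q]`. [folklore] -/
private theorem one_sub_X_ne_zero : (1 - Polynomial.X : Polynomial ℤ) ≠ 0 := by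
  intro h
  have := congrArg (fun p : Polynomial ℤ => p.coeff 0) h
  simp at this

/-- `1 - q² ≠ 0` in `ℤ[q]`. [folklore] -/
private theorem one_sub_X_sq_ne_zero : (1 - Polynomial.X ^ 2 : Polynomial ℤ) ≠ 0 := by
  intro h
  have := congrArg (fun p : Polynomial ℤ => p.coeff 0) h
  simp at this

/-- **The generating polynomial of `c_{(L,j,1)}` is symmetric in `(n,d)`**:
`binom(n,1)_q binom(n+d-1,n)_q = binom(d,1)_q binom(n+d-1,d)_q` (both are
`[n+d-1]_q! / ([n-1]_q! [d-1]_q!)`), so these terms cancel in `a_λ(d[n]) - a_λ(n[d])`.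
[cite: DorflerIkenmeyerPanova2020, Prop. 4.7 (proof, arXiv p. 11)] -/
theorem gaussBinomial_one_mul_symm (a b : ℕ) :
    gaussBinomial 1 a * gaussBinomial (a + 1) b = gaussBinomial 1 b * gaussBinomial (b + 1) a := by
  apply mul_left_cancel₀ one_sub_X_ne_zero
  rw [← mul_assoc, one_sub_X_mul_gaussBinomial_one, gaussBinomial_absorb_left, ← mul_assoc,
    one_sub_X_mul_gaussBinomial_one, gaussBinomial_absorb_left, gaussBinomial_symm b a, Nat.add_comm b a]

/-- The difference polynomial of Prop. 4.7 (before division): for `n = a+2`, `d = b+2`,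
`P := (1-q)·(G₂(d,n) - G₂(n,d))` with `G₂(d,n) = binom(n-1,1)_q binom(n+d-1,n)_q + binom(n+1,2)_q binom(n+d-2,n)_q`
satisfies `P · (1-q^d)(1-q^n) = binom(n+d-2,n-1)_q (q^n - q^d)(1-q^{d-1})(1-q^{n-1})`.
[cite: DorflerIkenmeyerPanova2020, Prop. 4.7 (arXiv p. 11; TeX multobs.tex L666 {prop:difference})] -/
theorem dip_prop47_polynomial_identity (a b : ℕ) :
    (1 - Polynomial.X) *
        ((gaussBinomial 1 a * gaussBinomial (a + 2) (b + 1) + gaussBinomial 2 (a + 1) * gaussBinomial (a + 2) b) -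
          (gaussBinomial 1 b * gaussBinomial (b + 2) (a + 1) + gaussBinomial 2 (b + 1) * gaussBinomial (b + 2) a)) *
        ((1 - Polynomial.X ^ (b + 2)) * (1 - Polynomial.X ^ (a + 2))) =
      gaussBinomial (a + 1) (b + 1) * (Polynomial.X ^ (a + 2) - Polynomial.X ^ (b + 2)) *
        (1 - Polynomial.X ^ (b + 1)) * (1 - Polynomial.X ^ (a + 1)) := by
  apply mul_right_cancel₀ one_sub_X_sq_ne_zero
  set F := gaussBinomial (a + 1) (b + 1) with hF
  -- the four closed forms
  have h1 : (1 - Polynomial.X) * (1 - Polynomial.X ^ (a + 2)) *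
      (gaussBinomial 1 a * gaussBinomial (a + 2) (b + 1)) =
      (1 - Polynomial.X ^ (a + 1)) * (1 - Polynomial.X ^ (a + b + 3)) * F := by
    have e1 := one_sub_X_mul_gaussBinomial_one a
    have e2 := gaussBinomial_absorb_left (a + 1) (b + 1)
    rw [show a + 1 + (b + 1) + 1 = a + b + 3 by ring, show a + 1 + 1 = a + 2 by ring] at e2
    linear_combination (1 - Polynomial.X ^ (a + 2)) * gaussBinomial (a + 2) (b + 1) * e1 +
      (1 - Polynomial.X ^ (a + 1)) * e2
  have h2 : (1 - Polynomial.X) * (1 - Polynomial.X ^ 2) * (1 - Polynomial.X ^ (a + 2)) *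
      (gaussBinomial 2 (a + 1) * gaussBinomial (a + 2) b) =
      (1 - Polynomial.X ^ (a + 2)) * (1 - Polynomial.X ^ (a + 3)) * (1 - Polynomial.X ^ (b + 1)) * F := by
    have e1 := one_sub_X_mul_one_sub_X_sq_mul_gaussBinomial_two (a + 1)
    have e2 := gaussBinomial_cross (a + 1) b
    rw [show a + 1 + 1 = a + 2 by ring] at e2
    rw [show a + 1 + 1 = a + 2 by ring, show a + 1 + 2 = a + 3 by ring] at e1
    linear_combination (1 - Polynomial.X ^ (a + 2)) * gaussBinomial (a + 2) b * e1 +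
      (1 - Polynomial.X ^ (a + 2)) * (1 - Polynomial.X ^ (a + 3)) * e2
  have h3 : (1 - Polynomial.X) * (1 - Polynomial.X ^ (b + 2)) *
      (gaussBinomial 1 b * gaussBinomial (b + 2) (a + 1)) =
      (1 - Polynomial.X ^ (b + 1)) * (1 - Polynomial.X ^ (a + b + 3)) * F := by
    have e1 := one_sub_X_mul_gaussBinomial_one b
    have e2 := gaussBinomial_absorb_left (b + 1) (a + 1)
    rw [show b + 1 + (a + 1) + 1 = a + b + 3 by ring, show b + 1 + 1 = b + 2 by ring,
      gaussBinomial_symm (b + 1) (a + 1)] at e2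
    linear_combination (1 - Polynomial.X ^ (b + 2)) * gaussBinomial (b + 2) (a + 1) * e1 +
      (1 - Polynomial.X ^ (b + 1)) * e2
  have h4 : (1 - Polynomial.X) * (1 - Polynomial.X ^ 2) * (1 - Polynomial.X ^ (b + 2)) *
      (gaussBinomial 2 (b + 1) * gaussBinomial (b + 2) a) =
      (1 - Polynomial.X ^ (b + 2)) * (1 - Polynomial.X ^ (b + 3)) * (1 - Polynomial.X ^ (a + 1)) * F := by
    have e1 := one_sub_X_mul_one_sub_X_sq_mul_gaussBinomial_two (b + 1)
    have e2 := gaussBinomial_cross (b + 1) a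
    rw [show b + 1 + 1 = b + 2 by ring, gaussBinomial_symm (b + 1) (a + 1)] at e2
    rw [show b + 1 + 1 = b + 2 by ring, show b + 1 + 2 = b + 3 by ring] at e1
    linear_combination (1 - Polynomial.X ^ (b + 2)) * gaussBinomial (b + 2) a * e1 +
      (1 - Polynomial.X ^ (b + 2)) * (1 - Polynomial.X ^ (b + 3)) * e2
  linear_combination ((1 - Polynomial.X ^ (b + 2)) * (1 - Polynomial.X ^ 2)) * h1 +
    (1 - Polynomial.X ^ (b + 2)) * h2 - ((1 - Polynomial.X ^ (a + 2)) * (1 - Polynomial.X ^ 2)) * h3 -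
    (1 - Polynomial.X ^ (a + 2)) * h4

end GeneratingPolynomials

/-! ### §G3. Prop. 4.7 from the corrected third identity of Prop. 4.5 -/

section Prop47

/-- `toRatPowerSeries` is multiplicative. [folklore] -/
private theorem toRatPowerSeries_mul (p q : Polynomial ℤ) :
    toRatPowerSeries (p * q) = toRatPowerSeries p * toRatPowerSeries q := by
  simp [toRatPowerSeries, Polynomial.map_mul, Polynomial.coe_mul]

/-- `toRatPowerSeries` respects differences. [folklore] -/
private theorem toRatPowerSeries_sub (p q : Polynomial ℤ) :
    toRatPowerSeries (p - q) = toRatPowerSeries p - toRatPowerSeries q := by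
  simp [toRatPowerSeries, Polynomial.map_sub]

/-- `toRatPowerSeries 1 = 1`. [folklore] -/
private theorem toRatPowerSeries_one : toRatPowerSeries 1 = 1 := by
  simp [toRatPowerSeries]

/-- `toRatPowerSeries (q^k) = q^k`. [folklore] -/
private theorem toRatPowerSeries_X_pow (k : ℕ) :
    toRatPowerSeries (Polynomial.X ^ k) = PowerSeries.X ^ k := by
  simp [toRatPowerSeries, Polynomial.coe_pow, Polynomial.coe_X]

/-- `toRatPowerSeries q = q`. [folklore] -/
private theorem toRatPowerSeries_X : toRatPowerSeries Polynomial.X = PowerSeries.X := by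
  simp [toRatPowerSeries, Polynomial.coe_X]

/-- Coefficients of `toRatPowerSeries p` are those of `p`. [folklore] -/
private theorem coeff_toRatPowerSeries (p : Polynomial ℤ) (k : ℕ) :
    PowerSeries.coeff k (toRatPowerSeries p) = (p.coeff k : ℚ) := by
  simp [toRatPowerSeries, Polynomial.coeff_coe]

/-- `(q^{j+1}) @ ((1-q) G) = G_{j+1} - G_j`. [folklore] -/
private theorem coeff_one_sub_X_mul (G : Polynomial ℤ) (j : ℕ) :
    ((1 - Polynomial.X) * G).coeff (j + 1) = G.coeff (j + 1) - G.coeff j := by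
  rw [sub_mul, one_mul, Polynomial.coeff_sub, Polynomial.coeff_X_mul]

/-- **Prop. 4.7 from Prop. 4.5 (i), (ii) and the CORRECTED third identity** (print erratum E2 of the
statement file: `c_{(L,k,2)}(d,n) = (q^k) @ (binom(n-1,1)_q binom(n+d-1,n)_q + binom(n+1,2)_q binom(n+d-2,n)_q)`,
here a hypothesis, to be discharged by the counting of the sibling file): with (4.4) written out
(`plethysmCoeff_row_two_two_cast_eq`), the `ν₃ = 0` terms (`p_k(n,d) = p_k(d,n)`) and the `ν₃ = 1` terms
(`gaussBinomial_one_mul_symm`) cancel in `a_λ(d[n]) - a_λ(n[d])`, which becomes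
`(q^r) @ (1-q)(G₂(d,n) - G₂(n,d))`; the `q`-binomial absorption rules
(`dip_prop47_polynomial_identity`) turn this into the printed
"`(q^r) @ binom(n+d-2,n-1)_q (q^n - q^d)(1-q^{d-1})(1-q^{n-1}) / ((1-q^d)(1-q^n))`".
[cite: DorflerIkenmeyerPanova2020, Prop. 4.7 (arXiv p. 11; TeX multobs.tex L666 {prop:difference}) with Props. 4.5–4.6 (proof route, arXiv pp. 9–11)] -/
theorem DIP20_prop_4_7_of_row_two_two
    (h22 : ∀ (n d L j : ℕ), 2 ≤ n → 2 ≤ d → L + j + 2 = d * n →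
      (dipMonomialCount ![L, j, 2] d n : ℤ) =
        (gaussBinomial 1 (n - 2) * gaussBinomial n (d - 1) +
          gaussBinomial 2 (n - 1) * gaussBinomial n (d - 2)).coeff j) :
    DIP20_prop_4_7 := by
  intro n d L r hn hd hr hrL hsum
  obtain ⟨a, rfl⟩ : ∃ a, n = a + 2 := ⟨n - 2, by omega⟩
  obtain ⟨b, rfl⟩ : ∃ b, d = b + 2 := ⟨d - 2, by omega⟩
  obtain ⟨t, rfl⟩ : ∃ t, r = t + 1 := ⟨r - 1, by omega⟩
  have ea1 : a + 2 - 1 = a + 1 := rfl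
  have ea2 : a + 2 - 2 = a := rfl
  have eb1 : b + 2 - 1 = b + 1 := rfl
  have eb2 : b + 2 - 2 = b := rfl
  simp only [ea1, eb1]
  have hsum' : L + (t + 1) + 2 = (a + 2) * (b + 2) := by rw [hsum]; ring
  -- (4.4) written out on both sides
  have hA := plethysmCoeff_row_two_two_cast_eq (n := a + 2) (d := b + 2) (by omega) hr hrL hsum
  have hB := plethysmCoeff_row_two_two_cast_eq (n := b + 2) (d := a + 2) (by omega) hr hrL hsum'
  simp only [Nat.add_sub_cancel] at hA hB
  -- the generating polynomials of the six terms
  have h2A := h22 (a + 2) (b + 2)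
  have h2B := h22 (b + 2) (a + 2)
  simp only [ea1, ea2, eb1, eb2] at h2A h2B
  have h1A : ∀ L j, L + j + 1 = (b + 2) * (a + 2) →
      (dipMonomialCount ![L, j, 1] (b + 2) (a + 2) : ℤ) =
        (gaussBinomial 1 (a + 1) * gaussBinomial (a + 2) (b + 1)).coeff j := fun L j hL => by
    rw [dipMonomialCount_row_two_one_cast (by omega) (by omega) hL, ea1, eb1]
  have h1B : ∀ L j, L + j + 1 = (a + 2) * (b + 2) →
      (dipMonomialCount ![L, j, 1] (a + 2) (b + 2) : ℤ) =
        (gaussBinomial 1 (b + 1) * gaussBinomial (b + 2) (a + 1)).coeff j := fun L j hL => by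
    rw [dipMonomialCount_row_two_one_cast (by omega) (by omega) hL, ea1, eb1]
  rw [h2A L (t + 1) (by omega) (by omega) hsum, h2A (L + 1) t (by omega) (by omega) (by omega),
    dipMonomialCount_row_two_zero_cast (show L + 2 + (t + 1) = (b + 2) * (a + 2) by omega),
    dipMonomialCount_row_two_zero_cast (show L + 1 + (t + 2) = (b + 2) * (a + 2) by omega),
    h1A L (t + 2) (by omega), h1A (L + 2) t (by omega)] at hA
  rw [h2B L (t + 1) (by omega) (by omega) hsum', h2B (L + 1) t (by omega) (by omega) (by omega),
    dipMonomialCount_row_two_zero_cast (show L + 2 + (t + 1) = (a + 2) * (b + 2) by omega),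
    dipMonomialCount_row_two_zero_cast (show L + 1 + (t + 2) = (a + 2) * (b + 2) by omega),
    h1B L (t + 2) (by omega), h1B (L + 2) t (by omega)] at hB
  -- the difference polynomial
  set F := gaussBinomial (a + 1) (b + 1) with hF
  set P := (1 - Polynomial.X) *
    ((gaussBinomial 1 a * gaussBinomial (a + 2) (b + 1) + gaussBinomial 2 (a + 1) * gaussBinomial (a + 2) b) -
      (gaussBinomial 1 b * gaussBinomial (b + 2) (a + 1) + gaussBinomial 2 (b + 1) * gaussBinomial (b + 2) a))
    with hP
  have hD : (plethysmCoeff ℂ (Fin 3) (a + 2) (rowDual ![L, t + 1, 2]) : ℤ) -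
      (plethysmCoeff ℂ (Fin 3) (b + 2) (rowDual ![L, t + 1, 2]) : ℤ) = P.coeff (t + 1) := by
    rw [hA, hB, hP, coeff_one_sub_X_mul, Polynomial.coeff_sub, Polynomial.coeff_sub,
      gaussBinomial_one_mul_symm (a + 1) (b + 1), gaussBinomial_symm (b + 2) (a + 2)]
    ring
  have hid : P * ((1 - Polynomial.X ^ (b + 2)) * (1 - Polynomial.X ^ (a + 2))) =
      F * (Polynomial.X ^ (a + 2) - Polynomial.X ^ (b + 2)) * (1 - Polynomial.X ^ (b + 1)) *
        (1 - Polynomial.X ^ (a + 1)) := dip_prop47_polynomial_identity a b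
  -- to `ℚ⟦q⟧`
  have hU : PowerSeries.constantCoeff
      ((1 - PowerSeries.X ^ (b + 2)) * (1 - PowerSeries.X ^ (a + 2)) : PowerSeries ℚ) ≠ 0 := by
    rw [map_mul, map_sub, map_sub, map_pow, map_pow, PowerSeries.constantCoeff_X, map_one,
      zero_pow (by omega), zero_pow (by omega), sub_zero, mul_one]
    exact one_ne_zero
  have hidQ : toRatPowerSeries P * ((1 - PowerSeries.X ^ (b + 2)) * (1 - PowerSeries.X ^ (a + 2))) =
      toRatPowerSeries F * (PowerSeries.X ^ (a + 2) - PowerSeries.X ^ (b + 2)) *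
        (1 - PowerSeries.X ^ (b + 1)) * (1 - PowerSeries.X ^ (a + 1)) := by
    have h := congrArg toRatPowerSeries hid
    rw [toRatPowerSeries_mul P] at h
    simpa only [toRatPowerSeries_mul, toRatPowerSeries_sub, toRatPowerSeries_one,
      toRatPowerSeries_X_pow] using h
  have key : toRatPowerSeries P =
      toRatPowerSeries F * (PowerSeries.X ^ (a + 2) - PowerSeries.X ^ (b + 2)) *
        (1 - PowerSeries.X ^ (b + 1)) * (1 - PowerSeries.X ^ (a + 1)) *
        ((1 - PowerSeries.X ^ (b + 2)) * (1 - PowerSeries.X ^ (a + 2)))⁻¹ := by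
    rw [← hidQ, mul_assoc, PowerSeries.mul_inv_cancel _ hU, mul_one]
  rw [← key, coeff_toRatPowerSeries, ← hD]
  push_cast
  ring

end Prop47

/-! ### §G4. Prop. 4.7 and Thm. 3.5 DISCHARGED; Cor. 4.8 for `r ≤ n` -/

section Discharge

/-- **Prop. 4.7 DISCHARGED**: "Let `λ = (L,r,2)`. We have that `a_λ(d[n]) - a_λ(n[d]) =
(q^r) @ binom(n+d-2,n-1)_q (q^n - q^d)(1-q^{d-1})(1-q^{n-1}) / ((1-q^d)(1-q^n))`" — by
`DIP20_prop_4_7_of_row_two_two` and the corrected third identity of Prop. 4.5, now a theorem of the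
sibling file (`dipMonomialCount_row_two_two_cast`, `DIP20MonomialCounts` §G).
[cite: DorflerIkenmeyerPanova2020, Prop. 4.7 (arXiv p. 11; TeX multobs.tex L666 {prop:difference})] -/
theorem DIP20_prop_4_7_holds : DIP20_prop_4_7 :=
  DIP20_prop_4_7_of_row_two_two fun _ _ _ _ hn hd hL => dipMonomialCount_row_two_two_cast hn hd hL

/-- **Thm. 3.5 DISCHARGED**: "`a_{(n²-2,n,2)}((n+1)[n]) = 1 + a_{(n²-2,n,2)}(n[n+1])`" for every `n ≥ 2`
(the statement file's `DIP20_thm_3_5_of_prop_4_7`, §Q, fed with `DIP20_prop_4_7_holds`).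
[cite: DorflerIkenmeyerPanova2020, Thm. 3.5 (arXiv p. 5; TeX multobs.tex L378 {thm:plethineq})] -/
theorem DIP20_thm_3_5_holds : DIP20_thm_3_5 :=
  DIP20_thm_3_5_of_prop_4_7 DIP20_prop_4_7_holds

/-- **Cor. 4.8, the clauses `r < n` and `r = n`, unconditionally**: for `d = n+1`,
`λ = (n²+n-2-r, r, 2)` with `2 ≤ r ≤ n`, `a_λ((n+1)[n]) - a_λ(n[n+1])` is `0` if `r < n` and `1` if
`r = n` (the statement file's `dip_cor48_diff_of_prop_4_7`, fed with `DIP20_prop_4_7_holds`). The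
clauses `r > n` of Cor. 4.8 need the unimodality of Gaussian coefficients [PP13] and stay open.
[cite: DorflerIkenmeyerPanova2020, Cor. 4.8 (arXiv p. 12; TeX multobs.tex L689 {cor:keyinequality})] -/
theorem dip20_cor_4_8_diff {n r : ℕ} (hn : 2 ≤ n) (hr : 2 ≤ r) (hrn : r ≤ n)
    (h2r : 2 * r ≤ n ^ 2 + n - 2) :
    ((plethysmCoeff ℂ (Fin 3) n (rowDual (dipFamilyRow n r)) : ℚ) -
        (plethysmCoeff ℂ (Fin 3) (n + 1) (rowDual (dipFamilyRow n r)) : ℚ)) =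
      (if r = n then 1 else 0 : ℚ) :=
  dip_cor48_diff_of_prop_4_7 DIP20_prop_4_7_holds hn hr hrn h2r

/-- **Cor. 4.8, clause `r < n`** (the second conjunct of `DIP20_cor_4_8`, for `2 ≤ r < n`):
`a_λ((n+1)[n]) = a_λ(n[n+1])`. [cite: DorflerIkenmeyerPanova2020, Cor. 4.8 (arXiv p. 12)] -/
theorem dip20_cor_4_8_of_lt {n r : ℕ} (hr : 2 ≤ r) (hrn : r < n) :
    plethysmCoeff ℂ (Fin 3) n (rowDual (dipFamilyRow n r)) =
      plethysmCoeff ℂ (Fin 3) (n + 1) (rowDual (dipFamilyRow n r)) := by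
  have h2r : 2 * r ≤ n ^ 2 + n - 2 := by
    have h4 : 2 * n ≤ n ^ 2 := by rw [pow_two]; exact Nat.mul_le_mul_right n (by omega)
    generalize n ^ 2 = q at h4 ⊢
    omega
  have h := dip20_cor_4_8_diff (by omega) hr hrn.le h2r
  rw [if_neg (Nat.ne_of_lt hrn)] at h
  exact_mod_cast sub_eq_zero.mp h

/-- **Cor. 4.8, clause `r = n`** (the third conjunct of `DIP20_cor_4_8`, `n ≥ 2`):
`a_λ((n+1)[n]) = a_λ(n[n+1]) + 1` for `λ = (n²-2, n, 2)`. [cite: DorflerIkenmeyerPanova2020, Cor. 4.8 (arXiv p. 12)] -/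
theorem dip20_cor_4_8_of_eq {n : ℕ} (hn : 2 ≤ n) :
    plethysmCoeff ℂ (Fin 3) n (rowDual (dipFamilyRow n n)) =
      plethysmCoeff ℂ (Fin 3) (n + 1) (rowDual (dipFamilyRow n n)) + 1 := by
  have h2r : 2 * n ≤ n ^ 2 + n - 2 := by
    have h4 : 2 * n ≤ n ^ 2 := by rw [pow_two]; exact Nat.mul_le_mul_right n hn
    generalize n ^ 2 = q at h4 ⊢
    omega
  have h := dip20_cor_4_8_diff hn hn le_rfl h2r
  rw [if_pos rfl] at h
  have h' : (plethysmCoeff ℂ (Fin 3) n (rowDual (dipFamilyRow n n)) : ℚ) =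
      plethysmCoeff ℂ (Fin 3) (n + 1) (rowDual (dipFamilyRow n n)) + 1 := by linarith
  exact_mod_cast h'

end Discharge

/-! ### §G5. Cor. 4.8 for `r > n`: the difference is a difference of Gaussian coefficients -/

section CorollaryGt

/-- `p_1(a,b) = 1` for `a, b ≥ 1` (the one-box partition). [cite: DorflerIkenmeyerPanova2020, §4 (arXiv p. 9: p_r(a,b))] -/
private theorem boxPartitionCount_one_eq_one (a b : ℕ) (ha : 1 ≤ a) (hb : 1 ≤ b) :
    boxPartitionCount 1 a b = 1 := by
  obtain ⟨c, rfl⟩ : ∃ c, b = c + 1 := ⟨b - 1, by omega⟩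
  induction a with
  | zero => omega
  | succ a ih =>
    rcases Nat.eq_zero_or_pos a with rfl | ha'
    · rw [Nat.zero_add, boxPartitionCount_one, if_pos (by omega)]
    · rw [boxPartitionCount_succ_succ, ih ha', if_neg (by omega)]

/-- `(1 - q^{n-1}) binom(2n-1,n-1)_q = (1 - q^{n+1}) binom(2n-1,n+1)_q` (`n = m+2`): the step
"`(1-q)(1-q^{n-1}) binom(2n-1,n-1)_q / (1-q^{n+1}) = (1-q) binom(2n-1,n+1)_q`" of the proof of Cor. 4.8.
[cite: DorflerIkenmeyerPanova2020, Cor. 4.8 (proof, arXiv p. 12)] -/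
private theorem gaussBinomial_shift_two (m : ℕ) :
    (1 - Polynomial.X ^ (m + 1)) * gaussBinomial (m + 1) (m + 2) =
      (1 - Polynomial.X ^ (m + 3)) * gaussBinomial (m + 3) m := by
  rw [gaussBinomial_symm (m + 1) (m + 2)]
  exact (gaussBinomial_cross (m + 2) m).symm

/-- **Cor. 4.8, the case `r > n`, as in its printed proof**: for `d = n+1`, `λ = (n²+n-2-r, r, 2)` with
`n+1 ≤ r`, `2r ≤ n²+n-2` (`n ≥ 2`): `a_λ((n+1)[n]) - a_λ(n[n+1]) = p_{r-n}(n+1,n-2) - p_{r-n-1}(n+1,n-2)`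
("the difference is `(q^r) @ q^n (1-q) binom(2n-1,n+1)_q = p_{k+1}(n+1,n-2) - p_k(n+1,n-2)` for
`r = n+k+1`", arXiv p. 12) — unconditionally, by `DIP20_prop_4_7_holds`. What remains of Cor. 4.8
(`≥ 0` always, `> 0` for `n ≥ 7`, `r ≥ n+2` off two exceptions) is thereby EXACTLY the (strict)
unimodality of the Gaussian coefficients `p_k(n+1,n-2)` below the middle ([PP13], not in the tree).
[cite: DorflerIkenmeyerPanova2020, Cor. 4.8 (proof, arXiv p. 12; TeX multobs.tex L689 {cor:keyinequality})] -/
theorem dip20_cor_4_8_diff_eq_boxCounts {n r : ℕ} (hn : 2 ≤ n) (hnr : n + 1 ≤ r)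
    (h2r : 2 * r ≤ n ^ 2 + n - 2) :
    ((plethysmCoeff ℂ (Fin 3) n (rowDual (dipFamilyRow n r)) : ℚ) -
        (plethysmCoeff ℂ (Fin 3) (n + 1) (rowDual (dipFamilyRow n r)) : ℚ)) =
      (boxPartitionCount (r - n) (n + 1) (n - 2) : ℚ) -
        boxPartitionCount (r - n - 1) (n + 1) (n - 2) := by
  obtain ⟨m, rfl⟩ : ∃ m, n = m + 2 := ⟨n - 2, by omega⟩
  have hsq : (m + 2) ^ 2 = m * m + 4 * m + 4 := by ring
  rw [hsq] at h2r
  have hL : m * m + 4 * m + 4 + (m + 2) - 2 - r + r + 2 = (m + 2 + 1) * (m + 2) := by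
    have hmul : (m + 2 + 1) * (m + 2) = m * m + 4 * m + 4 + (m + 2) := by ring
    rw [hmul]
    omega
  have h47 := DIP20_prop_4_7_holds (m + 2) (m + 2 + 1) (m * m + 4 * m + 4 + (m + 2) - 2 - r) r
    (by omega) (by omega) (by omega) (by omega) hL
  unfold dipFamilyRow
  rw [hsq, h47, dip_prop47_series_succ (m + 2) (by omega)]
  have e1 : m + 2 - 1 = m + 1 := rfl
  have e3 : m + 2 + 1 = m + 3 := rfl
  simp only [e1, e3]
  have hU : PowerSeries.constantCoeff ((1 : PowerSeries ℚ) - PowerSeries.X ^ (m + 3)) ≠ 0 := by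
    rw [map_sub, map_pow, PowerSeries.constantCoeff_X, map_one, zero_pow (by omega), sub_zero]
    exact one_ne_zero
  have hZ := congrArg toRatPowerSeries (gaussBinomial_shift_two m)
  rw [toRatPowerSeries_mul, toRatPowerSeries_mul, toRatPowerSeries_sub, toRatPowerSeries_sub,
    toRatPowerSeries_one, toRatPowerSeries_X_pow, toRatPowerSeries_X_pow] at hZ
  have key : (1 - PowerSeries.X) * (1 - PowerSeries.X ^ (m + 1)) *
      toRatPowerSeries (gaussBinomial (m + 1) (m + 2)) * ((1 : PowerSeries ℚ) - PowerSeries.X ^ (m + 3))⁻¹ =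
      toRatPowerSeries ((1 - Polynomial.X) * gaussBinomial (m + 3) m) := by
    rw [toRatPowerSeries_mul, toRatPowerSeries_sub, toRatPowerSeries_one, toRatPowerSeries_X,
      mul_assoc (1 - PowerSeries.X), hZ, mul_assoc (1 - PowerSeries.X), mul_assoc,
      mul_comm ((1 : PowerSeries ℚ) - PowerSeries.X ^ (m + 3)), mul_assoc,
      PowerSeries.inv_mul_cancel _ hU, mul_one]
  rw [key, ← toRatPowerSeries_X_pow, ← toRatPowerSeries_mul, coeff_toRatPowerSeries,
    Polynomial.coeff_X_pow_mul', if_pos (by omega : m + 2 ≤ r)]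
  have hr' : r - (m + 2) = (r - (m + 2) - 1) + 1 := by omega
  rw [hr', coeff_one_sub_X_mul, ← hr', coeff_gaussBinomial, coeff_gaussBinomial]
  push_cast
  rfl

/-- **Cor. 4.8, the printed exception `(n, r) = (8, 35)`** (the last conjunct of `DIP20_cor_4_8`):
`a_{(35,35,2)}(9[8]) = a_{(35,35,2)}(8[9])`, by the difference formula and `p_26(9,6) = 227 = p_27(9,6)`
(`DIP20_cor_4_8_boxCounts_holds`). [cite: DorflerIkenmeyerPanova2020, Cor. 4.8 (arXiv p. 12)] -/
theorem dip20_cor_4_8_eight_thirtyfive :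
    plethysmCoeff ℂ (Fin 3) 8 (rowDual (dipFamilyRow 8 35)) =
      plethysmCoeff ℂ (Fin 3) (8 + 1) (rowDual (dipFamilyRow 8 35)) := by
  have h := dip20_cor_4_8_diff_eq_boxCounts (n := 8) (r := 35) (by norm_num) (by norm_num) (by norm_num)
  obtain ⟨h26, h27⟩ := DIP20_cor_4_8_boxCounts_holds
  rw [show 35 - 8 = 27 by norm_num, show 27 - 1 = 26 by norm_num, show 8 - 2 = 6 by norm_num, h26, h27,
    sub_self] at h
  exact_mod_cast sub_eq_zero.mp h

/-- **The unlisted zero at `r = n+1`** (erratum candidate E3 of the statement file, now a theorem):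
for every `n ≥ 3`, `a_λ((n+1)[n]) = a_λ(n[n+1])` at `λ = (n²-3, n+1, 2)` — the printed "`> 0` when
`r > n`" fails at `r = n+1`, since `p_1(n+1,n-2) - p_0(n+1,n-2) = 1 - 1 = 0` by the printed proof's own
formula. [cite: DorflerIkenmeyerPanova2020, Cor. 4.8 (arXiv p. 12) — erratum candidate E3, see the statement file] -/
theorem dip20_cor_4_8_at_succ {n : ℕ} (hn : 3 ≤ n) :
    plethysmCoeff ℂ (Fin 3) n (rowDual (dipFamilyRow n (n + 1))) =
      plethysmCoeff ℂ (Fin 3) (n + 1) (rowDual (dipFamilyRow n (n + 1))) := by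
  have h2r : 2 * (n + 1) ≤ n ^ 2 + n - 2 := by
    have h3 : 3 * n ≤ n ^ 2 := by rw [pow_two]; exact Nat.mul_le_mul_right n hn
    generalize n ^ 2 = q at h3 ⊢
    omega
  have h := dip20_cor_4_8_diff_eq_boxCounts (by omega) le_rfl h2r
  rw [show n + 1 - n = 1 by omega, Nat.sub_self,
    boxPartitionCount_one_eq_one _ _ (by omega) (by omega), boxPartitionCount_zero, sub_self] at h
  exact_mod_cast sub_eq_zero.mp h

end CorollaryGt

/-! ### §G6. Cor. 4.8 reduced EXACTLY to the unimodality of the Gaussian coefficients `p_k(n+1,n-2)` -/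

section CorollaryReduction

/-- **Cor. 4.8 from Gaussian unimodality** (the printed proof, arXiv p. 12: "by the unimodality of the
Gaussian coefficients [PP13, Theorem 1.1] … strict unless …"): given (H1) the weak unimodality
`p_k(n+1,n-2) ≤ p_{k+1}(n+1,n-2)` below the middle (`2(n+k+1) ≤ n²+n-2`, i.e. `k+1 ≤ (n+1)(n-2)/2`)
and (H2) its strict form for `n ≥ 7`, `k ≥ 1` off the two exceptional pairs `(8,26)`, `(9,34)`
(Pak–Panova [PP13] as corrected by errata E3/E4 of the statement file), the typed `DIP20_cor_4_8`
follows — all its other ingredients (`r < n`, `r = n`, `(8,35)`, the difference formula) are theorems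
of this file. Neither (H1) (Sylvester 1878) nor (H2) is in the tree; they are hypotheses here, not facts.
[cite: DorflerIkenmeyerPanova2020, Cor. 4.8 (proof, arXiv p. 12; TeX multobs.tex L689 {cor:keyinequality})] -/
theorem DIP20_cor_4_8_of_gaussian_unimodality
    (H1 : ∀ n k : ℕ, 2 ≤ n → 2 * (n + k + 1) ≤ n ^ 2 + n - 2 →
      boxPartitionCount k (n + 1) (n - 2) ≤ boxPartitionCount (k + 1) (n + 1) (n - 2))
    (H2 : ∀ n k : ℕ, 7 ≤ n → 1 ≤ k → 2 * (n + k + 1) ≤ n ^ 2 + n - 2 → (n, k) ≠ (8, 26) →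
      (n, k) ≠ (9, 34) → boxPartitionCount k (n + 1) (n - 2) < boxPartitionCount (k + 1) (n + 1) (n - 2)) :
    DIP20_cor_4_8 := by
  intro n r hr h2r
  have hn : 2 ≤ n := by
    by_contra hlt
    have h0 : n ^ 2 + n - 2 = 0 := by interval_cases n <;> decide
    omega
  refine ⟨?_, fun hrn => dip20_cor_4_8_of_lt hr hrn, fun hrn => ?_, fun h7 hr2 h835 h944 => ?_,
    fun h8 h35 => ?_⟩
  · rcases lt_trichotomy r n with hlt | rfl | hgt
    · rw [dip20_cor_4_8_of_lt hr hlt]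
    · rw [dip20_cor_4_8_of_eq hn]
      exact Nat.le_succ _
    · have h := dip20_cor_4_8_diff_eq_boxCounts hn hgt h2r
      have hk := H1 n (r - n - 1) hn (by omega)
      rw [show r - n - 1 + 1 = r - n by omega] at hk
      have hk' : (boxPartitionCount (r - n - 1) (n + 1) (n - 2) : ℚ) ≤
          boxPartitionCount (r - n) (n + 1) (n - 2) := by exact_mod_cast hk
      have : (plethysmCoeff ℂ (Fin 3) (n + 1) (rowDual (dipFamilyRow n r)) : ℚ) ≤
          plethysmCoeff ℂ (Fin 3) n (rowDual (dipFamilyRow n r)) := by linarith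
      exact_mod_cast this
  · subst hrn
    exact dip20_cor_4_8_of_eq hn
  · have h := dip20_cor_4_8_diff_eq_boxCounts hn (by omega) h2r
    have hk := H2 n (r - n - 1) h7 (by omega) (by omega)
      (fun h => h835 (by rw [Prod.mk.injEq] at h ⊢; omega))
      (fun h => h944 (by rw [Prod.mk.injEq] at h ⊢; omega))
    rw [show r - n - 1 + 1 = r - n by omega] at hk
    have hk' : (boxPartitionCount (r - n - 1) (n + 1) (n - 2) : ℚ) <
        boxPartitionCount (r - n) (n + 1) (n - 2) := by exact_mod_cast hk
    have : (plethysmCoeff ℂ (Fin 3) (n + 1) (rowDual (dipFamilyRow n r)) : ℚ) <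
        plethysmCoeff ℂ (Fin 3) n (rowDual (dipFamilyRow n r)) := by linarith
    exact_mod_cast this
  · subst h8 h35
    exact dip20_cor_4_8_eight_thirtyfive

end CorollaryReduction

/-! ### §G7. The second, unlisted exception `(n, r) = (9, 44)` (erratum E4) -/

section SecondException

/-- `p_34(10,7) = 734 = p_35(10,7)` (`binom(17,7)_q` has equal coefficients at `q^{34}`, `q^{35}`), by
the kernel through `boxPartitionCount_eq_boxCount`. [cite: DorflerIkenmeyerPanova2020, Cor. 4.8 (proof, arXiv p. 12) — erratum candidate E4 of the statement file] -/
theorem boxPartitionCount_ten_seven_34_35 :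
    boxPartitionCount 34 10 7 = 734 ∧ boxPartitionCount 35 10 7 = 734 := by
  refine ⟨?_, ?_⟩ <;> rw [boxPartitionCount_eq_boxCount] <;> decide

/-- **The unlisted exception `(n, r) = (9, 44)`** (erratum candidate E4 of the statement file, now a
theorem): `a_{(44,44,2)}(10[9]) = a_{(44,44,2)}(9[10])`, since the difference is
`p_35(10,7) - p_34(10,7) = 734 - 734`. The printed Cor. 4.8 lists only `(8, 35)`.
[cite: DorflerIkenmeyerPanova2020, Cor. 4.8 (arXiv p. 12) — erratum candidate E4, see the statement file] -/
theorem dip20_cor_4_8_nine_fortyfour :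
    plethysmCoeff ℂ (Fin 3) 9 (rowDual (dipFamilyRow 9 44)) =
      plethysmCoeff ℂ (Fin 3) (9 + 1) (rowDual (dipFamilyRow 9 44)) := by
  have h := dip20_cor_4_8_diff_eq_boxCounts (n := 9) (r := 44) (by norm_num) (by norm_num) (by norm_num)
  obtain ⟨h34, h35⟩ := boxPartitionCount_ten_seven_34_35
  rw [show 44 - 9 = 35 by norm_num, show 35 - 1 = 34 by norm_num, show 9 - 2 = 7 by norm_num, h34, h35,
    sub_self] at h
  exact_mod_cast sub_eq_zero.mp h

end SecondException

end Literature.Computability.AlgebraicComplexity
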